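import Summits.Ventures.PercRepro.ProfilePointedCircuitClassesStarSharpPencilI

/-!
# PercRepro — THE PENCIL THROUGH `ℓ ∈ X`, PART J: A POINT OF `X` ON THE LINE `eℓ`
(p5, gen 56; `proofs/P5-GM1.md` §83)

When a second point `x` of `X` lies on the ON line `eℓ` (inside `P_f`) and `y` is the other point of `X − ℓ` on
`P_f`, the two bad demands `{ℓ, y} + e + b` and `{x, y} + e + b` make both `ℓ` and `x` C-points
(`pencilX_F_L_two_cpoints`): their B1 conditions coincide (`cl(X − ℓ − y) = cl(X − x − y)` through the line `eℓ`),
and in the B1 case `y` is off both planes because the remaining points of `X` are off `P_f`; in the B2 case `f` lies on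
the lines `ℓy` and `xy`, and `y` off the planes follows from the rank-4 conditions of the two demands.
-/

open scoped Matroid

namespace PercRepro.Cogirth

open Finset ThmH Skew Shadow Profile

open Classical

variable {α : Type} [DecidableEq α] {N : Matroid α} [N.Finite]

section StarSharpPencilJ

variable {b b' : α}

/-- `{e, x} ⊆ {e, f, x} ∩ ({ℓ, x} + e)`. -/
theorem pair_ex_subset_inter_efx_elx (e f l x : α) :
    ({e, x} : Finset α) ⊆ {e, f, x} ∩ insert e {l, x} := by
  intro z hz; simp only [mem_inter, mem_insert, mem_singleton] at hz ⊢; tauto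

/-- `{e, f, ℓ} ⊆ {e, f, x} ∪ ({ℓ, x} + e)`. -/
theorem efl_subset_union_efx_elx (e f l x : α) :
    ({e, f, l} : Finset α) ⊆ {e, f, x} ∪ insert e {l, x} := by
  intro z hz; simp only [mem_union, mem_insert, mem_singleton] at hz ⊢; tauto

/-- `{e, x} + ℓ = {ℓ, x} + e`. -/
theorem insert_l_ex_eq (e l x : α) : insert l ({e, x} : Finset α) = insert e {l, x} := by
  ext z; simp only [mem_insert, mem_singleton]; tauto

/-- `Z + x + e + ℓ = Z + ℓ + e + x`. -/
theorem insert_l_e_x_comm (Z : Finset α) (e l x : α) :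
    insert l (insert e (insert x Z)) = insert x (insert e (insert l Z)) := by
  ext z; simp only [mem_insert]; tauto

/-- `X ∖ {ℓ, y} = (X ∖ {ℓ, x, y}) + x` for `x ∈ X`, `x ≠ ℓ`, `x ≠ y`. -/
theorem sdiff_pair_eq_insert_sdiff_triple {X : Finset α} {l x y : α} (hx : x ∈ X) (hxl : x ≠ l) (hxy : x ≠ y) :
    X \ {l, y} = insert x (X \ {l, x, y}) := by
  ext z
  simp only [mem_insert, mem_sdiff, mem_singleton, not_or]
  constructor
  · rintro ⟨hz, hzl, hzy⟩
    by_cases hzx : z = x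
    · exact Or.inl hzx
    · exact Or.inr ⟨hz, hzl, hzx, hzy⟩
  · rintro (rfl | ⟨hz, hzl, -, hzy⟩)
    · exact ⟨hx, hxl, hxy⟩
    · exact ⟨hz, hzl, hzy⟩

/-- `X ∖ {x, y} = (X ∖ {ℓ, x, y}) + ℓ` for `ℓ ∈ X`, `ℓ ≠ x`, `ℓ ≠ y`. -/
theorem sdiff_pair_eq_insert_sdiff_triple' {X : Finset α} {l x y : α} (hl : l ∈ X) (hlx : l ≠ x) (hly : l ≠ y) :
    X \ {x, y} = insert l (X \ {l, x, y}) := by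
  ext z
  simp only [mem_insert, mem_sdiff, mem_singleton, not_or]
  constructor
  · rintro ⟨hz, hzx, hzy⟩
    by_cases hzl : z = l
    · exact Or.inl hzl
    · exact Or.inr ⟨hz, hzl, hzx, hzy⟩
  · rintro (rfl | ⟨hz, -, hzx, hzy⟩)
    · exact ⟨hl, hlx, hly⟩
    · exact ⟨hz, hzx, hzy⟩

/-- **A SECOND POINT `x` OF `X` ON THE LINE `eℓ` WITH TWO BAD DEMANDS `{ℓ, y}`, `{x, y}` MAKES `ℓ` AND `x` C-POINTS.** -/
theorem pencilX_F_L_two_cpoints (hn : (gr N).card = 9) (h : SeriesPair N b b') {e f : α} (he : e ∈ gr N)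
    (hf : f ∈ gr N) (hef : e ≠ f) (heb : e ≠ b) (heb' : e ≠ b') (hfb : f ≠ b) (hfb' : f ≠ b')
    (he1 : ∀ y ∈ ((((gr N).erase b).erase b').erase f).erase e, rk N {e, y} = 2)
    (hef2 : rk N {e, f} = 2)
    {l : α} (hlX : l ∈ ((((gr N).erase b).erase b').erase f).erase e) (hlon : rk N (insert b (insert b' {e, l})) = 3)
    (hefl : rk N {e, f, l} = 3)
    {x y : α} (hxX : x ∈ ((((gr N).erase b).erase b').erase f).erase e)
    (hyX : y ∈ ((((gr N).erase b).erase b').erase f).erase e) (hxy : x ≠ y) (hxl : x ≠ l) (hyl : y ≠ l)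
    (hxP : rk N (insert x {e, f, l}) = 3) (hyP : rk N (insert y {e, f, l}) = 3)
    (hxL : rk N (insert e {l, x}) = 2)
    (hA : ∀ z ∈ ((((gr N).erase b).erase b').erase f).erase e, z ≠ l → rk N (insert z {e, f, l}) = 3 →
      z = x ∨ z = y)
    (hWy : insert b (insert e {l, y}) ∈ d0DON N b' e f) (hc0y : ¬ d0c0 N b b' e f (insert b (insert e {l, y})))
    (hWxy : insert b (insert e {x, y}) ∈ d0DON N b' e f)
    (hc0xy : ¬ d0c0 N b b' e f (insert b (insert e {x, y}))) :
    (rk N {e, f, l} = 3 ∧ rk N ((((((gr N).erase b).erase b').erase f).erase e).erase l) = 4) ∧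
    (rk N {e, f, x} = 3 ∧ rk N ((((((gr N).erase b).erase b').erase f).erase e).erase x) = 4) := by
  set X := ((((gr N).erase b).erase b').erase f).erase e with hXdef
  have hXg : X ⊆ gr N :=
    (erase_subset _ _).trans ((erase_subset _ _).trans ((erase_subset _ _).trans (erase_subset _ _)))
  have hefl_sub : ({e, f, l} : Finset α) ⊆ gr N :=
    insert_subset he (insert_subset hf (singleton_subset_iff.2 (hXg hlX)))
  have hlP : rk N (insert l {e, f, l}) = 3 := by
    rw [insert_eq_of_mem (mem_insert_of_mem (mem_insert_of_mem (mem_singleton_self _)))]; exact hefl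
  have hdy := d0DON_pair_data hn h he hf hef heb heb' hfb hfb' hlX hyX hWy
  have hπey : rk N (insert e {l, y}) = 3 := hdy.1
  have hYfy : rk N (insert f (X \ {l, y})) = 4 := hdy.2.1
  have hτy : rk N (X \ {l, y}) = 3 := hdy.2.2.1
  have hdxy := d0DON_pair_data hn h he hf hef heb heb' hfb hfb' hxX hyX hWxy
  have hπexy : rk N (insert e {x, y}) = 3 := hdxy.1
  have hYfxy : rk N (insert f (X \ {x, y})) = 4 := hdxy.2.1
  have hτxy : rk N (X \ {x, y}) = 3 := hdxy.2.2.1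
  have hBy := pencilX_F_B1_or_B2 hn h he hf hef heb heb' hfb hfb' he1 hlX hlon hefl hlX hyX hyl.symm hlP hyP hWy hc0y
  have hBxy := pencilX_F_B1_or_B2 hn h he hf hef heb heb' hfb hfb' he1 hlX hlon hefl hxX hyX hxy hxP hyP hWxy hc0xy
  -- `x` is off the line `ef`
  have hefx : rk N {e, f, x} = 3 := by
    by_contra hne
    have h1 : rk N {e, f} ≤ rk N {e, f, x} := rk_mono' (pair_ef_subset_eft e f x)
    have h2 := rk_le_card' (M := N) ({e, f, x} : Finset α)
    have h3 := card_insert_le e ({f, x} : Finset α)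
    have h4 := card_le_two (a := f) (b := x)
    have hefx2 : rk N {e, f, x} = 2 := by rw [hef2] at h1; omega
    have hsm := rk_union_add_rk_le_of_subset_inter' (N := N) (S := {e, f, x}) (T := insert e {l, x}) (I := {e, x})
      (pair_ex_subset_inter_efx_elx e f l x)
    have h5 : rk N {e, f, l} ≤ rk N ({e, f, x} ∪ insert e {l, x}) := rk_mono' (efl_subset_union_efx_elx e f l x)
    rw [hefx2, hxL, he1 x hxX] at hsm
    rw [hefl] at h5
    omega
  -- a point of `X ∖ {ℓ, x, y}`, off `P_f`
  have hZc : (X \ {l, x, y}).card = 2 := by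
    rw [card_sdiff_of_subset, card_X_eq_five hn h he hf hef heb heb' hfb hfb']
    · rw [card_insert_of_notMem, card_pair hxy]
      simp only [mem_insert, mem_singleton, not_or]; exact ⟨hxl.symm, hyl.symm⟩
    · intro z hz; simp only [mem_insert, mem_singleton] at hz
      rcases hz with rfl | rfl | rfl
      · exact hlX
      · exact hxX
      · exact hyX
  obtain ⟨c, d, hcd, hZeq⟩ := card_eq_two.1 hZc
  have hcZ : c ∈ X \ {l, x, y} := by rw [hZeq]; exact mem_insert_self _ _
  have hcX : c ∈ X := (mem_sdiff.1 hcZ).1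
  have hc := (mem_sdiff.1 hcZ).2
  simp only [mem_insert, mem_singleton, not_or] at hc
  have hcP : rk N (insert c {e, f, l}) = 4 := by
    have h1 : rk N {e, f, l} ≤ rk N (insert c {e, f, l}) := rk_mono' (subset_insert _ _)
    have h2 := rk_insert_le_add_one (N := N) (hXg hcX) (X := ({e, f, l} : Finset α)) hefl_sub
    have h3 : ¬ rk N (insert c {e, f, l}) = 3 := fun h' => by
      rcases hA c hcX hc.1 h' with h'' | h''
      · exact hc.2.1 h''
      · exact hc.2.2 h''
    rw [hefl] at h1 h2
    omega
  -- the two complements through `Z = X ∖ {ℓ, x, y}`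
  have hXly : X \ {l, y} = insert x (X \ {l, x, y}) := sdiff_pair_eq_insert_sdiff_triple hxX hxl hxy
  have hXxy : X \ {x, y} = insert l (X \ {l, x, y}) := sdiff_pair_eq_insert_sdiff_triple' hlX hxl.symm hyl.symm
  have hXl : X.erase l = insert y (X \ {l, y}) := erase_eq_insert_sdiff_pair hyX hyl.symm
  have hXx : X.erase x = insert y (X \ {x, y}) := erase_eq_insert_sdiff_pair hyX hxy
  -- `ℓ ∈ cl{e, x}` and `x ∈ cl{e, ℓ}`
  have hlcl : rk N (insert l {e, x}) = rk N {e, x} := by rw [insert_l_ex_eq, hxL, he1 x hxX]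
  have hxcl : rk N (insert x {e, l}) = rk N {e, l} := by rw [← insert_e_lx_eq, hxL, he1 l hlX]
  -- the B1 conditions of the two demands coincide
  have hB1eq : rk N (insert e (X \ {l, y})) = rk N (insert e (X \ {x, y})) := by
    rw [hXly, hXxy]
    have h1 := rk_insert_eq_of_rk_insert_eq_subset' (N := N) (S := {e, x}) (S' := insert e (insert x (X \ {l, x, y})))
      (insert_subset (mem_insert_self _ _) (singleton_subset_iff.2 (mem_insert_of_mem (mem_insert_self _ _)))) hlcl
    have h2 := rk_insert_eq_of_rk_insert_eq_subset' (N := N) (S := {e, l}) (S' := insert e (insert l (X \ {l, x, y})))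
      (insert_subset (mem_insert_self _ _) (singleton_subset_iff.2 (mem_insert_of_mem (mem_insert_self _ _)))) hxcl
    rw [← h1, ← h2, insert_l_e_x_comm]
  -- `y ∈ cl(S)` for a complement `S ∋ ℓ, c` with `e ∈ cl(S)` and `ρ(S) = 3` is impossible
  have hkey : ∀ S : Finset α, S ⊆ X → rk N S = 3 → rk N (insert e S) = 3 → rk N (insert l S) = rk N S →
      c ∈ S → ¬ rk N (insert y S) = rk N S := by
    intro S hSX hS3 heS hlS hcS hyS
    have hU3 : rk N (insert y (insert l (insert e S))) = 3 := by
      have h1 := rk_insert_eq_of_rk_insert_eq_subset' (N := N) (S := S) (S' := insert e S) (subset_insert _ _) hlS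
      have h2 := rk_insert_eq_of_rk_insert_eq_subset' (N := N) (S := S) (S' := insert l (insert e S))
        ((subset_insert _ _).trans (subset_insert _ _)) hyS
      rw [h2, h1, heS]
    have hTU : insert e ({l, y} : Finset α) ⊆ insert y (insert l (insert e S)) :=
      insert_subset (mem_insert_of_mem (mem_insert_of_mem (mem_insert_self _ _)))
        (insert_subset (mem_insert_of_mem (mem_insert_self _ _)) (singleton_subset_iff.2 (mem_insert_self _ _)))
    have hccl : rk N (insert c (insert e {l, y})) = rk N (insert e {l, y}) :=
      rk_insert_eq_of_subset_rk_eq hTU (by rw [hU3, hπey])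
        (by rw [insert_eq_of_mem (mem_insert_of_mem (mem_insert_of_mem (mem_insert_of_mem hcS)))])
    have h3 := rk_insert_eq_of_rk_insert_eq_subset' (N := N) (S := insert e {l, y}) (S' := insert y {e, f, l})
      (insert_e_la_subset_insert_a_efl e f l y) hccl
    rw [hyP] at h3
    have h5 : rk N (insert c {e, f, l}) ≤ rk N (insert c (insert y {e, f, l})) :=
      rk_mono' (insert_c_efl_subset_insert_c_insert_a e f l y c)
    rw [h3, hcP] at h5
    omega
  have hcly : c ∈ X \ {l, y} := mem_sdiff.2 ⟨hcX, by
    simp only [mem_insert, mem_singleton, not_or]; exact ⟨hc.1, hc.2.2⟩⟩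
  have hcxy : c ∈ X \ {x, y} := mem_sdiff.2 ⟨hcX, by
    simp only [mem_insert, mem_singleton, not_or]; exact ⟨hc.2.1, hc.2.2⟩⟩
  have hy_bound : ∀ S : Finset α, S ⊆ X → rk N S = 3 → rk N (insert y S) ≤ 4 ∧ 3 ≤ rk N (insert y S) := by
    intro S hSX hS3
    have h1 := rk_insert_le_add_one (N := N) (hXg hyX) (X := S) (hSX.trans hXg)
    have h2 : rk N S ≤ rk N (insert y S) := rk_mono' (subset_insert _ _)
    omega
  by_cases hB1 : rk N (insert e (X \ {l, y})) = 3
  · -- the B1 case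
    have hB1' : rk N (insert e (X \ {x, y})) = 3 := by rw [← hB1eq]; exact hB1
    have hlS : rk N (insert l (X \ {l, y})) = rk N (X \ {l, y}) := by
      have h1 := rk_insert_eq_of_rk_insert_eq_subset' (N := N) (S := {e, x}) (S' := insert e (X \ {l, y}))
        (insert_subset (mem_insert_self _ _) (singleton_subset_iff.2 (mem_insert_of_mem
          (by rw [hXly]; exact mem_insert_self _ _)))) hlcl
      have h2 : rk N (insert l (X \ {l, y})) ≤ rk N (insert l (insert e (X \ {l, y}))) :=
        rk_mono' (insert_subset_insert _ (subset_insert _ _))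
      have h3 : rk N (X \ {l, y}) ≤ rk N (insert l (X \ {l, y})) := rk_mono' (subset_insert _ _)
      rw [h1, hB1] at h2
      rw [hτy] at h3 ⊢
      omega
    refine ⟨⟨hefl, ?_⟩, hefx, ?_⟩
    · rw [hXl]
      have := hy_bound (X \ {l, y}) sdiff_subset hτy
      have hn3 := hkey (X \ {l, y}) sdiff_subset hτy hB1 hlS hcly
      rw [hτy] at hn3
      omega
    · rw [hXx]
      have := hy_bound (X \ {x, y}) sdiff_subset hτxy
      have hlS' : rk N (insert l (X \ {x, y})) = rk N (X \ {x, y}) := by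
        rw [insert_eq_of_mem (by rw [hXxy]; exact mem_insert_self _ _)]
      have hn3 := hkey (X \ {x, y}) sdiff_subset hτxy hB1' hlS' hcxy
      rw [hτxy] at hn3
      omega
  · -- the B2 case: `f` on the lines `ℓy` and `xy`
    have hB2y : rk N (insert f {l, y}) = 2 := hBy.resolve_right hB1
    have hB2xy : rk N (insert f {x, y}) = 2 := hBxy.resolve_right (by rw [← hB1eq]; exact hB1)
    have hxy2 : rk N {x, y} = 2 := by
      have h1 := rk_insert_le_add_one (N := N) he (X := ({x, y} : Finset α))
        (insert_subset (hXg hxX) (singleton_subset_iff.2 (hXg hyX)))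
      have h2 := rk_le_card' (M := N) ({x, y} : Finset α)
      have h3 := card_le_two (a := x) (b := y)
      rw [hπexy] at h1
      omega
    have hly2 : rk N {l, y} = 2 := by
      have h1 := rk_insert_le_add_one (N := N) he (X := ({l, y} : Finset α))
        (insert_subset (hXg hlX) (singleton_subset_iff.2 (hXg hyX)))
      have h2 := rk_le_card' (M := N) ({l, y} : Finset α)
      have h3 := card_le_two (a := l) (b := y)
      rw [hπey] at h1
      omega
    refine ⟨⟨hefl, ?_⟩, hefx, ?_⟩
    · rw [hXl]
      have := hy_bound (X \ {l, y}) sdiff_subset hτy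
      by_contra hne
      have hycl : rk N (insert y (X \ {l, y})) = rk N (X \ {l, y}) := by rw [hτy]; omega
      have hfcl : rk N (insert f {x, y}) = rk N {x, y} := by rw [hB2xy, hxy2]
      have hsub : ({x, y} : Finset α) ⊆ insert y (X \ {l, y}) :=
        insert_subset (mem_insert_of_mem (by rw [hXly]; exact mem_insert_self _ _))
          (singleton_subset_iff.2 (mem_insert_self _ _))
      have h1 := rk_insert_eq_of_rk_insert_eq_subset' (N := N) hsub hfcl
      have h2 : rk N (insert f (X \ {l, y})) ≤ rk N (insert f (insert y (X \ {l, y}))) :=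
        rk_mono' (insert_subset_insert _ (subset_insert _ _))
      rw [h1, hycl, hτy] at h2
      rw [hYfy] at h2
      omega
    · rw [hXx]
      have := hy_bound (X \ {x, y}) sdiff_subset hτxy
      by_contra hne
      have hycl : rk N (insert y (X \ {x, y})) = rk N (X \ {x, y}) := by rw [hτxy]; omega
      have hfcl : rk N (insert f {l, y}) = rk N {l, y} := by rw [hB2y, hly2]
      have hsub : ({l, y} : Finset α) ⊆ insert y (X \ {x, y}) :=
        insert_subset (mem_insert_of_mem (by rw [hXxy]; exact mem_insert_self _ _))
          (singleton_subset_iff.2 (mem_insert_self _ _))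
      have h1 := rk_insert_eq_of_rk_insert_eq_subset' (N := N) hsub hfcl
      have h2 : rk N (insert f (X \ {x, y})) ≤ rk N (insert f (insert y (X \ {x, y}))) :=
        rk_mono' (insert_subset_insert _ (subset_insert _ _))
      rw [h1, hycl, hτxy] at h2
      rw [hYfxy] at h2
      omega

/-- A C-point on `P_f` gives a C-target of the F-class. -/
theorem pencilX_F_cpoint_target_mem (hn : (gr N).card = 9) (h : SeriesPair N b b') {e f : α} (he : e ∈ gr N)
    (hf : f ∈ gr N) (hef : e ≠ f) (heb : e ≠ b) (heb' : e ≠ b') (hfb : f ≠ b) (hfb' : f ≠ b') {l : α}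
    {x : α} (hx : x ∈ ((((gr N).erase b).erase b').erase f).erase e)
    (hefx : rk N {e, f, x} = 3) (hx4 : rk N ((((((gr N).erase b).erase b').erase f).erase e).erase x) = 4)
    (hxP : rk N (insert l {e, f, x}) ≤ 3) :
    insert b {e, f, x} ∈ (biIndepSets N 4).filter (fun W => ((f ∈ W ∧ b' ∉ W) ∧ (e ∈ W ∧ b ∈ W)) ∧
      ¬ rk N (insert l (W.erase b)) = 4) := by
  have hmem := cpoint_target_mem hn h he hf hef heb heb' hfb hfb' hx hefx hx4
  simp only [mem_filter] at hmem ⊢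
  refine ⟨hmem.1, hmem.2, ?_⟩
  rw [erase_insert (b_notMem_efx heb hfb hx)]
  omega

/-- The pair of a bad demand of the F-class lies in `{ℓ} ∪ A`. -/
theorem pencilX_F_mem_structure (hn : (gr N).card = 9) (h : SeriesPair N b b') {e f : α} (he : e ∈ gr N)
    (hf : f ∈ gr N) (hef : e ≠ f) (heb : e ≠ b) (heb' : e ≠ b') (hfb : f ≠ b) (hfb' : f ≠ b')
    (he1 : ∀ y ∈ ((((gr N).erase b).erase b').erase f).erase e, rk N {e, y} = 2) (heb3 : rk N {e, b, b'} = 3)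
    {l : α} (hlX : l ∈ ((((gr N).erase b).erase b').erase f).erase e) (hlon : rk N (insert b (insert b' {e, l})) = 3)
    {W : Finset α} (hW : W ∈ d0DON N b' e f) (hc1 : ¬ d0c1 N b e f W) :
    ∃ π : Finset α, π ⊆ insert l ((((((gr N).erase b).erase b').erase f).erase e).filter
        (fun x => x ≠ l ∧ rk N (insert f (insert e {l, x})) ≤ 3)) ∧ π.card = 2 ∧ W = insert b (insert e π) := by
  have hWd := hW
  simp only [d0DON, mem_filter] at hWd
  obtain ⟨-, hπX, hπ2, hYeq, hWeq, -, -, -⟩ :=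
    d0_demand_data h hn hf hef heb hfb hfb' (e := e) W hWd.1 hWd.2.1 hWd.2.2
  have hP := pencilX_F_pair_in_Pf hn h he hf hef heb heb' hfb hfb' he1 heb3 hlX hlon hW hc1
  refine ⟨(W.erase b).erase e, ?_, hπ2, by rw [hYeq, hWeq]⟩
  intro x hx
  by_cases hxl : x = l
  · rw [hxl]; exact mem_insert_self _ _
  · exact mem_insert_of_mem (mem_filter.2 ⟨hπX hx, hxl, hP x hx⟩)

end StarSharpPencilJ

end PercRepro.Cogirth
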